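import Mathlib
import Literature.NumberTheory.LFunctions.Zhang2022.TypedSection15AIdentities
import Literature.NumberTheory.LFunctions.Zhang2022.Section15Bcoef
import Literature.NumberTheory.LFunctions.Zhang2022.Section17Eq171Residue
import Literature.NumberTheory.LFunctions.Zhang2022.ToolkitDivisorMajorants
import Literature.NumberTheory.LFunctions.Zhang2022.Section6ZfacBound
import HarnessLib

/-!
# Zhang (2022) §15 u009 (p. 80, tex L4037), second half: the segment `𝔍(−1)` replaced by the line
# `σ = −1/2` for every `ψ ∈ Ψ` — kernel-checked

Topic `Literature/NumberTheory/LFunctions/Zhang2022` (Landau–Siegel audit tree; verdict-neutral).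
Y. Zhang, *Discrete mean estimates and the Landau–Siegel zero*, arXiv:2211.02515v1 (2022)
[Zhang2022LandauSiegel] — **an unrefereed manuscript under adjudication; nothing here asserts or
denies its Theorems 1–2.** ZHANG-L discharge lane (helper under leaf `Typed.Section15A.Eq15_6`, via
the tree edge `eq15_4_of : Step15_u008 → Step15_u009 → Step15_u012 → Eq15_4`); THEOREM-ONLY.

§15 p. 80 (tex L4037), inside the proof of (15.4), step `Z22:§15.u009`:

> … and then the segment `𝔍(−1)` can be replaced by the line `σ = −1/2`, with acceptable errors.

For every `ψ ∈ Ψ` the `𝔍(−1)`-integral of u008, `(1/2πi)∫_{𝔍(−1)} (Σ_m k̃(m)ψ̄(Dm)(Dm)^{s−1})B(s,ψ)ω(s)ds`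
(`Typed.Section15A.ktildeSeries`, `Skeleton.Bpoly`, `Skeleton.omegaW`; `𝔍(−1)` = the segment
`σ = −1/2`, `|t − 2πt₀| ≤ 𝓛₁` — the tree's `Lemma81.segInt (t₀) (𝓛₁) (−1)`), differs from the integral
over the whole line `σ = −1/2` by the two tails `|t − 2πt₀| > 𝓛₁`, on which the integrand is bounded by
`K₀e·e^{−(t−2πt₀)²/(4𝓛₂²)}`, `K₀ = D^{−3/2}S₄·C_b⌈PT⁻²⌉³·(√π/𝓛₂)` (`S₄ = Σ_m τ₄(m)m^{−3/2}`,
`|k̃(m)| ≤ τ₄(m)` by `Typed.Section15A.norm_ktilde_le`, `|b(n)| ≤ C_bτ₂(n)` by `Skeleton.norm_bcoef_le`):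
each tail is `≤ K₀e·4𝓛³⁹⁵e^{−𝓛¹⁰/4}`. Summed over the `≤ 𝔓` members of `Ψ`
(`Ded81Edge.natCard_chr_le_frakP`) with the weights `|τ(χ)χ(p)(pt₀)^{−β₃}| = √D`, the total is
`≤ C·e^{−𝓛¹⁰/8}·𝔓` (`u009_line_le`), in particular `o(𝔓)` (`u009_line_eventually`: the typed half
`Step15_u009b` of `TypedSection15ASubsteps`, stated here with its two abbreviations unfolded).

| decl | content |
|---|---|
| `norm_ktildeSeries_le`, `continuous_ktildeSeries_line` | the `m`-series on `σ = −1/2`: `≤ D^{−3/2}S₄`, continuous in `t` |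
| `norm_Bpoly_le_neg_half` | `‖B(−1/2+it,ψ)‖ ≤ C_b·⌈PT⁻²⌉³` |
| `norm_lineIntegrand_le`, `continuous_lineIntegrand`, `integrable_lineIntegrand` | the integrand on `σ = −1/2` |
| `segInt_sub_line_le` | per `ψ`: `‖∫_{𝔍(−1)} − ∫_{(−1/2)}‖ ≤ K₀·8e𝓛³⁹⁵e^{−𝓛¹⁰/4}` |
| `u009_line_le`, `u009_line_eventually` | **summed over `Ψ` with the weights of u008: `≤ Ce^{−𝓛¹⁰/8}𝔓`, hence `o(𝔓)`** |

## References

* Y. Zhang, arXiv:2211.02515v1 (2022), §15 p. 80, tex L4033–L4041; §2 (2.15); §7 p. 35, tex L1920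
  (the model "segment ↦ line" step). [cite: Zhang2022LandauSiegel, §15 p. 80]
-/

noncomputable section

open Complex Real MeasureTheory Set Filter
open scoped ComplexConjugate

namespace Literature.NumberTheory.LFunctions.Zhang2022.Typed.Section15A.U009

open Skeleton

variable (c' : ℝ) {D : ℕ}

/-! ## Points of the line `σ = −1/2` and of the segment `𝔍(−1)` -/

/-- The real part of `−1/2 + it`. [folklore] -/
private theorem re_linePt (t : ℝ) : ((-1 / 2 + t * I : ℂ)).re = -1 / 2 := by
  simp

/-- The imaginary part of `−1/2 + it`. [folklore] -/
private theorem im_linePt (t : ℝ) : ((-1 / 2 + t * I : ℂ)).im = t := by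
  simp

/-- `−1 + s₀ + iv = −1/2 + i(2πt₀ + v)` (`s₀ = 1/2 + 2πit₀`): the segment `𝔍(−1)` lies on `σ = −1/2`.
[cite: Zhang2022LandauSiegel, §7 p. 33 (definition of `𝔍(z)`)] -/
theorem seg_point_eq (D : ℕ) (v : ℝ) :
    (-1 : ℂ) + SmoothWeight.s0 (t0 D) + (v : ℂ) * I =
      (-1 / 2 + ((2 * π * t0 D + v : ℝ) : ℂ) * I : ℂ) := by
  rw [SmoothWeight.s0_def]
  push_cast
  ring

/-! ## The `m`-series `Σ_m k̃(m)ψ̄(Dm)(Dm)^{s−1}` on `σ = −1/2` -/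

/-- Termwise size on `σ = −1/2`: `|k̃(m)ψ̄(Dm)(Dm)^{s−1}| ≤ D^{−3/2}·τ₄(m)m^{−3/2}` (`|k̃| ≤ τ₄`,
`Typed.Section15A.norm_ktilde_le`; `|(Dm)^{−(1−s)}| = (Dm)^{−3/2}`).
[cite: Zhang2022LandauSiegel, §15 p. 80, tex L4029] -/
theorem norm_ktildeSeries_term_le [NeZero D] (x : Chr D) (hℓ : 0 < ell D) {s : ℂ}
    (hs : s.re = -1 / 2) (m : ℕ) :
    ‖ktilde c' D m * conj (x.ψ ((D * m : ℕ) : ZMod x.p)) / ((D * m : ℕ) : ℂ) ^ (1 - s)‖ ≤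
      (D : ℝ) ^ (-(3 / 2 : ℝ)) * (MeanSquareMajorant.tau 4 m * (m : ℝ) ^ (-(3 / 2 : ℝ))) := by
  have hD0 : 0 < D := Nat.pos_of_ne_zero (NeZero.ne D)
  rcases Nat.eq_zero_or_pos m with rfl | hm
  · have h1s : (1 : ℂ) - s ≠ 0 := by
      intro h; have := congrArg Complex.re h; simp [hs] at this; norm_num at this
    simp only [Nat.mul_zero, Nat.cast_zero, Complex.zero_cpow h1s, div_zero, norm_zero]
    exact mul_nonneg (Real.rpow_nonneg (Nat.cast_nonneg D) _)
      (mul_nonneg (MeanSquareMajorant.tau_nonneg 4 0) (Real.rpow_nonneg le_rfl _))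
  · have hDm : 0 < D * m := Nat.mul_pos hD0 hm
    rw [norm_div, norm_mul, Complex.norm_conj, Complex.norm_natCast_cpow_of_pos hDm, Complex.sub_re,
      Complex.one_re, hs]
    have h1 : ‖ktilde c' D m‖ ≤ MeanSquareMajorant.tau 4 m := norm_ktilde_le c' hℓ m
    have h2 : ‖x.ψ ((D * m : ℕ) : ZMod x.p)‖ ≤ 1 := DirichletCharacter.norm_le_one _ _
    have hpow : ((D * m : ℕ) : ℝ) ^ ((1 : ℝ) - -1 / 2) = ((D : ℝ) ^ (-(3 / 2 : ℝ)) * (m : ℝ) ^ (-(3 / 2 : ℝ)))⁻¹ := by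
      rw [Nat.cast_mul, show ((1 : ℝ) - -1 / 2) = -(-(3 / 2 : ℝ)) by norm_num,
        Real.rpow_neg (by positivity), Real.mul_rpow (Nat.cast_nonneg D) (Nat.cast_nonneg m)]
    rw [hpow, div_eq_mul_inv, inv_inv]
    have h0 : 0 ≤ (D : ℝ) ^ (-(3 / 2 : ℝ)) * (m : ℝ) ^ (-(3 / 2 : ℝ)) :=
      mul_nonneg (Real.rpow_nonneg (Nat.cast_nonneg D) _) (Real.rpow_nonneg (Nat.cast_nonneg m) _)
    calc ‖ktilde c' D m‖ * ‖x.ψ ((D * m : ℕ) : ZMod x.p)‖ * ((D : ℝ) ^ (-(3 / 2 : ℝ)) * (m : ℝ) ^ (-(3 / 2 : ℝ)))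
        ≤ MeanSquareMajorant.tau 4 m * 1 * ((D : ℝ) ^ (-(3 / 2 : ℝ)) * (m : ℝ) ^ (-(3 / 2 : ℝ))) :=
          mul_le_mul_of_nonneg_right (mul_le_mul h1 h2 (norm_nonneg _)
            (MeanSquareMajorant.tau_nonneg 4 m)) h0
      _ = (D : ℝ) ^ (-(3 / 2 : ℝ)) * (MeanSquareMajorant.tau 4 m * (m : ℝ) ^ (-(3 / 2 : ℝ))) := by ring

/-- **Size of the `m`-series on `σ = −1/2`**: `‖Σ_m k̃(m)ψ̄(Dm)(Dm)^{s−1}‖ ≤ D^{−3/2}·S₄`,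
`S₄ = Σ_m τ₄(m)m^{−3/2}`. [cite: Zhang2022LandauSiegel, §15 p. 80, tex L4037] -/
theorem norm_ktildeSeries_le [NeZero D] (x : Chr D) (hℓ : 0 < ell D) {s : ℂ} (hs : s.re = -1 / 2) :
    ‖ktildeSeries c' x s‖ ≤
      (D : ℝ) ^ (-(3 / 2 : ℝ)) * ∑' m : ℕ, MeanSquareMajorant.tau 4 m * (m : ℝ) ^ (-(3 / 2 : ℝ)) := by
  have hsum := MeanSquareMajorant.summable_tau_mul_rpow_neg 4 (σ := 3 / 2) (by norm_num)
  have h := tsum_of_norm_bounded (hsum.mul_left ((D : ℝ) ^ (-(3 / 2 : ℝ)))).hasSum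
    fun m => norm_ktildeSeries_term_le c' x hℓ hs m
  rw [tsum_mul_left] at h
  exact h

/-- **Continuity of `t ↦ Σ_m k̃(m)ψ̄(Dm)(Dm)^{(−1/2+it)−1}`** (uniformly dominated series of continuous
terms). [cite: Zhang2022LandauSiegel, §15 p. 80, tex L4037] -/
theorem continuous_ktildeSeries_line [NeZero D] (x : Chr D) (hℓ : 0 < ell D) :
    Continuous fun t : ℝ => ktildeSeries c' x (-1 / 2 + t * I) := by
  have hD0 : 0 < D := Nat.pos_of_ne_zero (NeZero.ne D)
  have hsum := (MeanSquareMajorant.summable_tau_mul_rpow_neg 4 (σ := 3 / 2) (by norm_num)).mul_left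
    ((D : ℝ) ^ (-(3 / 2 : ℝ)))
  unfold ktildeSeries
  refine continuous_tsum (fun m => ?_) hsum fun m t =>
    norm_ktildeSeries_term_le c' x hℓ (re_linePt t) m
  rcases Nat.eq_zero_or_pos m with rfl | hm
  · have h : (fun t : ℝ => ktilde c' D 0 * conj (x.ψ ((D * 0 : ℕ) : ZMod x.p)) /
        ((D * 0 : ℕ) : ℂ) ^ (1 - (-1 / 2 + t * I : ℂ))) = fun _ => 0 := by
      funext t
      have h1s : (1 : ℂ) - (-1 / 2 + t * I) ≠ 0 := by
        intro h; have := congrArg Complex.re h; simp at this; norm_num at this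
      simp only [Nat.mul_zero, Nat.cast_zero, Complex.zero_cpow h1s, div_zero]
    rw [h]; exact continuous_const
  · have hDm : ((D * m : ℕ) : ℂ) ≠ 0 := Nat.cast_ne_zero.mpr (Nat.mul_pos hD0 hm).ne'
    refine continuous_const.div ?_ fun t => ?_
    · exact continuous_const.cpow (by fun_prop) fun t => Or.inl (by exact_mod_cast Nat.mul_pos hD0 hm)
    · exact (cpow_ne_zero_iff_of_exponent_ne_zero (by
        intro h; have := congrArg Complex.re h; simp at this; norm_num at this)).mpr hDm

/-! ## `B(s,ψ)` on `σ = −1/2` -/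

/-- **`‖B(s,ψ)‖ ≤ C_b·⌈PT⁻²⌉³` for `Re s = −1/2`** (`C_b = (1+|ι₂|)(|ι₃|+|ι₄|)`): by (15.1)–(15.2)
(`Skeleton.Bpoly_eq_sum_bcoef`, `Skeleton.norm_bcoef_le`) `B` is a sum of `< ⌈PT⁻²⌉` terms
`b(n)χψ(n)n^{−s}`, each of modulus `≤ C_bτ₂(n)n^{1/2} ≤ C_b·n·n`. A crude polynomial bound.
[cite: Zhang2022LandauSiegel, §15 (15.1)–(15.2) p. 79] -/
theorem norm_Bpoly_le_neg_half [NeZero D] (χ : DirichletCharacter ℂ D) (x : Chr D)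
    (hℓ : 3 ≤ ell D) {s : ℂ} (hs : s.re = -1 / 2) :
    ‖Bpoly χ x s‖ ≤ (1 + ‖iota2‖) * (‖iota3‖ + ‖iota4‖) * (⌈bigP D / bigT D ^ 2⌉₊ : ℝ) ^ 3 := by
  set N : ℕ := ⌈bigP D / bigT D ^ 2⌉₊ with hN
  set Cb : ℝ := (1 + ‖iota2‖) * (‖iota3‖ + ‖iota4‖) with hCb
  have hCb0 : 0 ≤ Cb := by positivity
  have hℓ2 : 2 ≤ Real.log D := by have : ell D = Real.log D := rfl; linarith
  rw [Bpoly_eq_sum_bcoef χ x hℓ (N := N) (Nat.le_ceil _) s]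
  have hterm : ∀ n ∈ Finset.range N, ‖bcoef D n * pc χ x n * (n : ℂ) ^ (-s)‖ ≤ Cb * (N : ℝ) ^ 2 := by
    intro n hn
    have hnN : n < N := Finset.mem_range.mp hn
    rcases Nat.eq_zero_or_pos n with rfl | hn0
    · have hs0 : -s ≠ 0 := by
        intro h; have := congrArg Complex.re h; simp [hs] at this
      rw [Nat.cast_zero, Complex.zero_cpow hs0, mul_zero, norm_zero]; positivity
    rw [norm_mul, norm_mul]
    have h1 : ‖bcoef D n‖ ≤ Cb * MeanSquareMajorant.tau 2 n := norm_bcoef_le hℓ2 n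
    have h2 : ‖pc χ x n‖ ≤ 1 := by
      rw [pc, norm_mul]
      calc ‖x.ψ (n : ZMod x.p)‖ * ‖χ (n : ZMod D)‖ ≤ 1 * 1 :=
            mul_le_mul (DirichletCharacter.norm_le_one _ _) (DirichletCharacter.norm_le_one _ _)
              (norm_nonneg _) zero_le_one
        _ = 1 := mul_one _
    have h3 : ‖(n : ℂ) ^ (-s)‖ ≤ (N : ℝ) := by
      rw [Complex.norm_natCast_cpow_of_pos hn0, Complex.neg_re, hs]
      have hn1 : (1 : ℝ) ≤ n := by exact_mod_cast hn0
      calc (n : ℝ) ^ (-(-1 / 2 : ℝ)) ≤ (n : ℝ) ^ (1 : ℝ) :=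
            Real.rpow_le_rpow_of_exponent_le hn1 (by norm_num)
        _ = n := Real.rpow_one _
        _ ≤ N := by exact_mod_cast hnN.le
    have h4 : MeanSquareMajorant.tau 2 n ≤ (N : ℝ) := by
      rw [MeanSquareMajorant.tau_two_apply]
      exact_mod_cast (Nat.card_divisors_le_self n).trans hnN.le
    have hCt : 0 ≤ Cb * MeanSquareMajorant.tau 2 n := mul_nonneg hCb0 (MeanSquareMajorant.tau_nonneg 2 n)
    calc ‖bcoef D n‖ * ‖pc χ x n‖ * ‖(n : ℂ) ^ (-s)‖ ≤ (Cb * MeanSquareMajorant.tau 2 n) * 1 * N :=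
          mul_le_mul (mul_le_mul h1 h2 (norm_nonneg _) hCt) h3 (norm_nonneg _)
            (by rw [mul_one]; exact hCt)
      _ ≤ Cb * N * 1 * N :=
          mul_le_mul_of_nonneg_right (mul_le_mul_of_nonneg_right
            (mul_le_mul_of_nonneg_left h4 hCb0) zero_le_one) (Nat.cast_nonneg N)
      _ = Cb * (N : ℝ) ^ 2 := by ring
  calc ‖∑ n ∈ Finset.range N, bcoef D n * pc χ x n * (n : ℂ) ^ (-s)‖
      ≤ ∑ n ∈ Finset.range N, ‖bcoef D n * pc χ x n * (n : ℂ) ^ (-s)‖ := norm_sum_le _ _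
    _ ≤ ∑ n ∈ Finset.range N, Cb * (N : ℝ) ^ 2 := Finset.sum_le_sum hterm
    _ = (N : ℝ) * (Cb * (N : ℝ) ^ 2) := by rw [Finset.sum_const, Finset.card_range, nsmul_eq_mul]
    _ = Cb * (N : ℝ) ^ 3 := by ring

/-! ## The integrand on the line `σ = −1/2` -/

/-- Continuity of `t ↦ ω(−1/2+it)` ((2.15)). [cite: Zhang2022LandauSiegel, §2 (2.15)] -/
theorem continuous_omega_line (D : ℕ) :
    Continuous fun t : ℝ => omegaW D (-1 / 2 + t * I) := by
  unfold omegaW SmoothWeight.omega SmoothWeight.s0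
  fun_prop

/-- **Continuity of the integrand `(Σ_m k̃ψ̄(Dm)(Dm)^{s−1})B(s,ψ)ω(s)` along `σ = −1/2`.**
[cite: Zhang2022LandauSiegel, §15 p. 80, tex L4037] -/
theorem continuous_lineIntegrand [NeZero D] (χ : DirichletCharacter ℂ D) (x : Chr D)
    (hℓ : 0 < ell D) :
    Continuous fun t : ℝ => ktildeSeries c' x (-1 / 2 + t * I) * Bpoly χ x (-1 / 2 + t * I) *
      omegaW D (-1 / 2 + t * I) := by
  have hB : Continuous fun t : ℝ => Bpoly χ x (-1 / 2 + t * I) :=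
    (Typed.Section17.differentiable_Bpoly χ x).continuous.comp
      (by fun_prop : Continuous fun t : ℝ => (-1 / 2 + (t : ℂ) * I : ℂ))
  exact ((continuous_ktildeSeries_line c' x hℓ).mul hB).mul (continuous_omega_line D)

/-- **Size of the integrand on `σ = −1/2`**: for `𝓛 ≥ 3` and every real `t`,
`‖(Σ_m …)(−1/2+it)·B(−1/2+it,ψ)·ω(−1/2+it)‖ ≤ K₀·exp((1 − (t−2πt₀)²)/(4𝓛₂²))`,
`K₀ = D^{−3/2}S₄·C_b⌈PT⁻²⌉³·(√π/𝓛₂)` (`|ω|` EXACT, `SmoothWeight.norm_omega_eq`; no polynomial growth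
in `t`). [cite: Zhang2022LandauSiegel, §15 p. 80, tex L4037] -/
theorem norm_lineIntegrand_le [NeZero D] (χ : DirichletCharacter ℂ D) (x : Chr D) (hℓ : 3 ≤ ell D)
    (t : ℝ) :
    ‖ktildeSeries c' x (-1 / 2 + t * I) * Bpoly χ x (-1 / 2 + t * I) * omegaW D (-1 / 2 + t * I)‖ ≤
      ((D : ℝ) ^ (-(3 / 2 : ℝ)) * (∑' m : ℕ, MeanSquareMajorant.tau 4 m * (m : ℝ) ^ (-(3 / 2 : ℝ))) *
        ((1 + ‖iota2‖) * (‖iota3‖ + ‖iota4‖) * (⌈bigP D / bigT D ^ 2⌉₊ : ℝ) ^ 3) *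
        (Real.sqrt π / ell2 D)) *
      Real.exp ((1 - (t - 2 * π * t0 D) ^ 2) / (4 * ell2 D ^ 2)) := by
  have hℓ0 : 0 < ell D := by linarith
  have hℓ₂ : 0 < ell2 D := by rw [ell2]; positivity
  have hK := norm_ktildeSeries_le c' x hℓ0 (re_linePt t)
  have hB := norm_Bpoly_le_neg_half χ x hℓ (re_linePt t)
  have hω : ‖omegaW D (-1 / 2 + t * I)‖ =
      Real.sqrt π / ell2 D * Real.exp ((1 - (t - 2 * π * t0 D) ^ 2) / (4 * ell2 D ^ 2)) := by
    rw [omegaW, SmoothWeight.norm_omega_eq hℓ₂, re_linePt, im_linePt]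
    norm_num
  have hS0 : 0 ≤ (D : ℝ) ^ (-(3 / 2 : ℝ)) * ∑' m : ℕ, MeanSquareMajorant.tau 4 m * (m : ℝ) ^ (-(3 / 2 : ℝ)) :=
    mul_nonneg (Real.rpow_nonneg (Nat.cast_nonneg D) _) (tsum_nonneg fun m =>
      mul_nonneg (MeanSquareMajorant.tau_nonneg 4 m) (Real.rpow_nonneg (Nat.cast_nonneg m) _))
  rw [norm_mul, norm_mul, hω]
  have hω0 : 0 ≤ Real.sqrt π / ell2 D * Real.exp ((1 - (t - 2 * π * t0 D) ^ 2) / (4 * ell2 D ^ 2)) :=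
    mul_nonneg (div_nonneg (Real.sqrt_nonneg _) hℓ₂.le) (Real.exp_pos _).le
  calc ‖ktildeSeries c' x (-1 / 2 + t * I)‖ * ‖Bpoly χ x (-1 / 2 + t * I)‖ *
        (Real.sqrt π / ell2 D * Real.exp ((1 - (t - 2 * π * t0 D) ^ 2) / (4 * ell2 D ^ 2)))
      ≤ ((D : ℝ) ^ (-(3 / 2 : ℝ)) * ∑' m : ℕ, MeanSquareMajorant.tau 4 m * (m : ℝ) ^ (-(3 / 2 : ℝ))) *
          ((1 + ‖iota2‖) * (‖iota3‖ + ‖iota4‖) * (⌈bigP D / bigT D ^ 2⌉₊ : ℝ) ^ 3) *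
          (Real.sqrt π / ell2 D * Real.exp ((1 - (t - 2 * π * t0 D) ^ 2) / (4 * ell2 D ^ 2))) :=
        mul_le_mul_of_nonneg_right (mul_le_mul hK hB (norm_nonneg _) hS0) hω0
    _ = _ := by ring

/-- **Integrability of the integrand along `σ = −1/2`** (continuous, Gaussian majorant), for `𝓛 ≥ 3`.
[cite: Zhang2022LandauSiegel, §15 p. 80, tex L4037] -/
theorem integrable_lineIntegrand [NeZero D] (χ : DirichletCharacter ℂ D) (x : Chr D) (hℓ : 3 ≤ ell D) :
    Integrable fun t : ℝ => ktildeSeries c' x (-1 / 2 + t * I) * Bpoly χ x (-1 / 2 + t * I) *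
      omegaW D (-1 / 2 + t * I) := by
  have hℓ0 : 0 < ell D := by linarith
  have hℓ₂ : 0 < ell2 D := by rw [ell2]; positivity
  have hb : 0 < 1 / (4 * ell2 D ^ 2) := by positivity
  set K₀ : ℝ := ((D : ℝ) ^ (-(3 / 2 : ℝ)) * (∑' m : ℕ, MeanSquareMajorant.tau 4 m * (m : ℝ) ^ (-(3 / 2 : ℝ))) *
    ((1 + ‖iota2‖) * (‖iota3‖ + ‖iota4‖) * (⌈bigP D / bigT D ^ 2⌉₊ : ℝ) ^ 3) *
    (Real.sqrt π / ell2 D)) with hK₀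
  have hg : Integrable fun t : ℝ => K₀ * Real.exp (1 / (4 * ell2 D ^ 2)) *
      Real.exp (-(1 / (4 * ell2 D ^ 2)) * (t - 2 * π * t0 D) ^ 2) :=
    ((integrable_exp_neg_mul_sq hb).comp_sub_right (2 * π * t0 D)).const_mul _
  refine hg.mono' (continuous_lineIntegrand c' χ x hℓ0).aestronglyMeasurable (ae_of_all _ fun t => ?_)
  refine (norm_lineIntegrand_le c' χ x hℓ t).trans (le_of_eq ?_)
  have hsplit : Real.exp ((1 - (t - 2 * π * t0 D) ^ 2) / (4 * ell2 D ^ 2)) =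
      Real.exp (1 / (4 * ell2 D ^ 2)) * Real.exp (-(1 / (4 * ell2 D ^ 2)) * (t - 2 * π * t0 D) ^ 2) := by
    rw [← Real.exp_add]; congr 1; field_simp; ring
  rw [hsplit, ← mul_assoc]

/-! ## Per `ψ`: the segment `𝔍(−1)` against the line `σ = −1/2` -/

/-- **Per `ψ ∈ Ψ`: `‖(1/2πi)∫_{𝔍(−1)} KBω − (1/2π)∫_ℝ (KBω)(−1/2+it)dt‖ ≤ K₀·8e𝓛³⁹⁵e^{−𝓛¹⁰/4}`** (for
`D ≥ 9`): the segment is the piece `|t − 2πt₀| ≤ 𝓛₁` of the line, and on the two tails the Gaussian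
majorant `K₀e·e^{−(t−2πt₀)²/(4𝓛₂²)} ≤ K₀e·e^{−γ|t−2πt₀|}` (`γ = 𝓛₁/(4𝓛₂²)`) integrates to
`≤ K₀e·e^{−γ𝓛₁}/γ = K₀e·4𝓛³⁹⁵e^{−𝓛¹⁰/4}` each. [cite: Zhang2022LandauSiegel, §15 p. 80, tex L4037] -/
theorem segInt_sub_line_le [NeZero D] (χ : DirichletCharacter ℂ D) (hD : 9 ≤ D) (hℓ3 : 3 ≤ ell D)
    (x : Chr D) :
    ‖Lemma81.segInt (t0 D) (ell1 D) (-1) (fun s => ktildeSeries c' x s * Bpoly χ x s * omegaW D s) -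
        (1 / (2 * π) : ℂ) * ∫ t : ℝ, ktildeSeries c' x (-1 / 2 + t * I) * Bpoly χ x (-1 / 2 + t * I) *
          omegaW D (-1 / 2 + t * I)‖ ≤
      ((D : ℝ) ^ (-(3 / 2 : ℝ)) * (∑' m : ℕ, MeanSquareMajorant.tau 4 m * (m : ℝ) ^ (-(3 / 2 : ℝ))) *
        ((1 + ‖iota2‖) * (‖iota3‖ + ‖iota4‖) * (⌈bigP D / bigT D ^ 2⌉₊ : ℝ) ^ 3) *
        (Real.sqrt π / ell2 D)) * (8 * Real.exp 1 * ell D ^ 395 * Real.exp (-(ell D ^ 10) / 4)) := by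
  have hℓ := Section6TailBounds.two_le_ell hD
  have hℓ0 : 0 < ell D := by linarith
  have hℓ₂ : 0 < ell2 D := by rw [ell2]; positivity
  have hℓ₂1 : 1 ≤ ell2 D := by rw [ell2]; exact one_le_pow₀ (by linarith)
  -- the integrand and its Gaussian majorant
  set G : ℝ → ℂ := fun t => ktildeSeries c' x (-1 / 2 + t * I) * Bpoly χ x (-1 / 2 + t * I) *
    omegaW D (-1 / 2 + t * I) with hGdef
  set K₀ : ℝ := ((D : ℝ) ^ (-(3 / 2 : ℝ)) * (∑' m : ℕ, MeanSquareMajorant.tau 4 m * (m : ℝ) ^ (-(3 / 2 : ℝ))) *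
    ((1 + ‖iota2‖) * (‖iota3‖ + ‖iota4‖) * (⌈bigP D / bigT D ^ 2⌉₊ : ℝ) ^ 3) *
    (Real.sqrt π / ell2 D)) with hK₀
  have hK₀0 : 0 ≤ K₀ := by
    rw [hK₀]
    refine mul_nonneg (mul_nonneg (mul_nonneg (Real.rpow_nonneg (Nat.cast_nonneg D) _)
      (tsum_nonneg fun m => mul_nonneg (MeanSquareMajorant.tau_nonneg 4 m)
        (Real.rpow_nonneg (Nat.cast_nonneg m) _))) (by positivity))
      (div_nonneg (Real.sqrt_nonneg _) hℓ₂.le)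
  set K₁ : ℝ := K₀ * Real.exp 1 with hK₁
  have hK₁0 : 0 ≤ K₁ := mul_nonneg hK₀0 (Real.exp_pos _).le
  set c : ℝ := 2 * π * t0 D with hc
  set L₁ : ℝ := ell1 D with hL₁
  have hL₁0 : 0 < L₁ := by rw [hL₁, ell1]; positivity
  have hGint : Integrable G := integrable_lineIntegrand c' χ x hℓ3
  have hGbd : ∀ t : ℝ, ‖G t‖ ≤ K₁ * Real.exp (-(1 / (4 * ell2 D ^ 2)) * (t - c) ^ 2) := by
    intro t
    refine (norm_lineIntegrand_le c' χ x hℓ3 t).trans ?_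
    have hsplit : Real.exp ((1 - (t - c) ^ 2) / (4 * ell2 D ^ 2)) =
        Real.exp (1 / (4 * ell2 D ^ 2)) * Real.exp (-(1 / (4 * ell2 D ^ 2)) * (t - c) ^ 2) := by
      rw [← Real.exp_add]; congr 1; field_simp; ring
    have he1 : Real.exp (1 / (4 * ell2 D ^ 2)) ≤ Real.exp 1 := by
      apply Real.exp_le_exp.mpr
      rw [div_le_one (by positivity)]
      nlinarith
    rw [← hc, hsplit, ← mul_assoc]
    exact mul_le_mul_of_nonneg_right (mul_le_mul_of_nonneg_left he1 hK₀0) (Real.exp_pos _).le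
  -- the segment integral is the middle piece of the line integral
  have hseg : Lemma81.segInt (t0 D) (ell1 D) (-1)
      (fun s => ktildeSeries c' x s * Bpoly χ x s * omegaW D s) =
        (1 / (2 * π) : ℂ) * ∫ v in (-L₁)..L₁, G (v + c) := by
    have hpt : ∀ v : ℝ, (-1 : ℂ) + SmoothWeight.s0 (t0 D) + (v : ℂ) * I =
        (-1 / 2 + ((v + c : ℝ) : ℂ) * I : ℂ) := by
      intro v; rw [seg_point_eq, hc]; push_cast; ring
    rw [Lemma81.segInt]
    congr 1
    refine intervalIntegral.integral_congr fun v _ => ?_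
    simp only [hGdef, hpt]
  have hsplit : ∫ t : ℝ, G t = (∫ t in Set.Iic (c - L₁), G t) +
      ((∫ v in (-L₁)..L₁, G (v + c)) + ∫ t in Set.Ioi (c + L₁), G t) := by
    have h1 := intervalIntegral.integral_Iic_add_Ioi (hGint.integrableOn (s := Set.Iic (c - L₁)))
      (hGint.integrableOn (s := Set.Ioi (c - L₁)))
    have h2 := intervalIntegral.integral_Ioi_sub_Ioi (hGint.integrableOn (s := Set.Ioi (c - L₁)))
      (by linarith : c - L₁ ≤ c + L₁)
    have h3 : ∫ t in (c - L₁)..(c + L₁), G t = ∫ v in (-L₁)..L₁, G (v + c) := by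
      rw [intervalIntegral.integral_comp_add_right G c]
      congr 1 <;> ring
    rw [← h1, ← h3]
    have h2' : ∫ t in Set.Ioi (c - L₁), G t =
        (∫ t in (c - L₁)..(c + L₁), G t) + ∫ t in Set.Ioi (c + L₁), G t := by
      rw [← h2]; ring
    rw [h2']
  -- the two tails
  set γ : ℝ := L₁ / (4 * ell2 D ^ 2) with hγ
  have h4 : 0 < 4 * ell2 D ^ 2 := by positivity
  have hγ0 : 0 < γ := by rw [hγ]; exact div_pos hL₁0 h4
  have htailR : ‖∫ t in Set.Ioi (c + L₁), G t‖ ≤ K₁ * (Real.exp (-γ * L₁) / γ) := by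
    have hpt : ∀ t ∈ Set.Ioi (c + L₁), ‖G t‖ ≤ K₁ * Real.exp (γ * c) * Real.exp (-γ * t) := by
      intro t ht
      have htc : L₁ ≤ t - c := by have := Set.mem_Ioi.mp ht; linarith
      refine (hGbd t).trans ?_
      rw [show K₁ * Real.exp (γ * c) * Real.exp (-γ * t) = K₁ * Real.exp (γ * c + -γ * t) by
        rw [Real.exp_add]; ring]
      apply mul_le_mul_of_nonneg_left _ hK₁0
      apply Real.exp_le_exp.mpr
      have key : L₁ * (t - c) ≤ (t - c) ^ 2 := by nlinarith
      have h1 : -(1 / (4 * ell2 D ^ 2)) * (t - c) ^ 2 ≤ -(L₁ / (4 * ell2 D ^ 2)) * (t - c) := by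
        rw [show -(1 / (4 * ell2 D ^ 2)) * (t - c) ^ 2 = -((t - c) ^ 2) / (4 * ell2 D ^ 2) by ring,
          show -(L₁ / (4 * ell2 D ^ 2)) * (t - c) = -(L₁ * (t - c)) / (4 * ell2 D ^ 2) by ring]
        exact div_le_div_of_nonneg_right (by linarith) h4.le
      have h2 : -(L₁ / (4 * ell2 D ^ 2)) * (t - c) = γ * c + -γ * t := by rw [hγ]; ring
      linarith
    have hgi : IntegrableOn (fun t => K₁ * Real.exp (γ * c) * Real.exp (-γ * t))
        (Set.Ioi (c + L₁)) :=
      (integrableOn_exp_mul_Ioi (by linarith : -γ < 0) _).const_mul _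
    have hb := norm_integral_le_of_norm_le hgi
      ((ae_restrict_iff' measurableSet_Ioi).mpr (ae_of_all _ hpt))
    refine hb.trans_eq ?_
    rw [integral_const_mul, integral_exp_mul_Ioi (by linarith : -γ < 0)]
    have : Real.exp (γ * c) * (-Real.exp (-γ * (c + L₁)) / -γ) = Real.exp (-γ * L₁) / γ := by
      rw [neg_div_neg_eq, ← mul_div_assoc, ← Real.exp_add]
      congr 1; ring_nf
    rw [mul_assoc, this]
  have htailL : ‖∫ t in Set.Iic (c - L₁), G t‖ ≤ K₁ * (Real.exp (-γ * L₁) / γ) := by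
    have hpt : ∀ t ∈ Set.Iic (c - L₁), ‖G t‖ ≤ K₁ * Real.exp (-γ * c) * Real.exp (γ * t) := by
      intro t ht
      have htc : L₁ ≤ c - t := by have := Set.mem_Iic.mp ht; linarith
      refine (hGbd t).trans ?_
      rw [show K₁ * Real.exp (-γ * c) * Real.exp (γ * t) = K₁ * Real.exp (-γ * c + γ * t) by
        rw [Real.exp_add]; ring]
      apply mul_le_mul_of_nonneg_left _ hK₁0
      apply Real.exp_le_exp.mpr
      have key : L₁ * (c - t) ≤ (t - c) ^ 2 := by nlinarith
      have h1 : -(1 / (4 * ell2 D ^ 2)) * (t - c) ^ 2 ≤ -(L₁ / (4 * ell2 D ^ 2)) * (c - t) := by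
        rw [show -(1 / (4 * ell2 D ^ 2)) * (t - c) ^ 2 = -((t - c) ^ 2) / (4 * ell2 D ^ 2) by ring,
          show -(L₁ / (4 * ell2 D ^ 2)) * (c - t) = -(L₁ * (c - t)) / (4 * ell2 D ^ 2) by ring]
        exact div_le_div_of_nonneg_right (by linarith) h4.le
      have h2 : -(L₁ / (4 * ell2 D ^ 2)) * (c - t) = -γ * c + γ * t := by rw [hγ]; ring
      linarith
    have hgi : IntegrableOn (fun t => K₁ * Real.exp (-γ * c) * Real.exp (γ * t))
        (Set.Iic (c - L₁)) :=
      (integrableOn_exp_mul_Iic hγ0 _).const_mul _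
    have hb := norm_integral_le_of_norm_le hgi
      ((ae_restrict_iff' measurableSet_Iic).mpr (ae_of_all _ hpt))
    refine hb.trans_eq ?_
    rw [integral_const_mul, integral_exp_mul_Iic hγ0]
    have : Real.exp (-γ * c) * (Real.exp (γ * (c - L₁)) / γ) = Real.exp (-γ * L₁) / γ := by
      rw [← mul_div_assoc, ← Real.exp_add]
      congr 1; ring_nf
    rw [mul_assoc, this]
  -- the value of the tail majorant: `e^{−γ𝓛₁}/γ = 4𝓛³⁹⁵ e^{−𝓛¹⁰/4}`
  have hγval : Real.exp (-γ * L₁) / γ = 4 * ell D ^ 395 * Real.exp (-(ell D ^ 10) / 4) := by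
    have hℓne : ell D ≠ 0 := hℓ0.ne'
    have e1 : -γ * L₁ = -(ell D ^ 10) / 4 := by
      rw [hγ, hL₁, ell1, ell2]; field_simp
    have e2 : 1 / γ = 4 * ell D ^ 395 := by
      rw [hγ, hL₁, ell1, ell2]; field_simp
    rw [div_eq_mul_one_div, e1, e2]; ring
  -- assemble
  have hdiff : Lemma81.segInt (t0 D) (ell1 D) (-1)
      (fun s => ktildeSeries c' x s * Bpoly χ x s * omegaW D s) - (1 / (2 * π) : ℂ) * ∫ t : ℝ, G t =
      -((1 / (2 * π) : ℂ) * ((∫ t in Set.Iic (c - L₁), G t) + ∫ t in Set.Ioi (c + L₁), G t)) := by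
    rw [hseg, hsplit]; ring
  have hnormc : ‖(1 / (2 * π) : ℂ)‖ ≤ 1 := by
    rw [show (1 / (2 * π) : ℂ) = ((1 / (2 * π) : ℝ) : ℂ) by push_cast; ring, Complex.norm_real,
      Real.norm_of_nonneg (by positivity), div_le_one (by positivity)]
    linarith [Real.pi_gt_three]
  rw [hdiff, norm_neg, norm_mul]
  calc ‖(1 / (2 * π) : ℂ)‖ * ‖(∫ t in Set.Iic (c - L₁), G t) + ∫ t in Set.Ioi (c + L₁), G t‖
      ≤ 1 * (‖∫ t in Set.Iic (c - L₁), G t‖ + ‖∫ t in Set.Ioi (c + L₁), G t‖) :=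
        mul_le_mul hnormc (norm_add_le _ _) (norm_nonneg _) zero_le_one
    _ ≤ K₁ * (Real.exp (-γ * L₁) / γ) + K₁ * (Real.exp (-γ * L₁) / γ) := by
        rw [one_mul]; exact add_le_add htailL htailR
    _ = K₀ * (8 * Real.exp 1 * ell D ^ 395 * Real.exp (-(ell D ^ 10) / 4)) := by
        rw [hγval, hK₁]; ring

/-! ## Summed over `Ψ` with the weights `τ(χ)χ(p)(pt₀)^{−β₃}` of u008 -/

/-- `|(pt₀)^{−β₃}| = 1` (`β₃` purely imaginary, `pt₀ > 0`). [cite: Zhang2022LandauSiegel, §2 (2.13)] -/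
theorem norm_pt0_cpow_neg_beta3 (x : Chr D) (ht0 : 0 < t0 D) :
    ‖(((x.p : ℝ) * t0 D : ℝ) : ℂ) ^ (-beta3 c' D)‖ = 1 := by
  have hp : (0 : ℝ) < x.p := Nat.cast_pos.mpr x.prime.pos
  rw [Complex.norm_cpow_eq_rpow_re_of_pos (mul_pos hp ht0)]
  simp [beta3]

/-- `|τ(χ)| = √D` for the primitive `χ (mod D)`. [cite: Zhang2022LandauSiegel, §2 (2.4) p.4] -/
theorem norm_tau_eq_sqrt [NeZero D] {χ : DirichletCharacter ℂ D} (hp : χ.IsPrimitive) :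
    ‖GammaFactor.tau χ‖ = Real.sqrt D := by
  have h := Literature.NumberTheory.Sieve.LargeSieve.norm_gaussSum_sq hp
  rw [GammaFactor.tau, ← Real.sqrt_sq (norm_nonneg _), h]

/-- For `𝓛 ≥ 64` (and `D ≥ 1`): `√D·⌈PT⁻²⌉³·𝓛³⁹⁵·e^{−𝓛¹⁰/4} ≤ e^{−𝓛¹⁰/8}` (`⌈PT⁻²⌉ ≤ P + 1 ≤ e^{𝓛⁹+1}`,
`√D ≤ D = e^{𝓛}`, `𝓛³⁹⁵ ≤ e^{395𝓛}`, `3(𝓛⁹+1) + 396𝓛 ≤ 𝓛¹⁰/8`).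
[cite: Zhang2022LandauSiegel, §15 p. 80, tex L4037] -/
private theorem prefactor_le {D : ℕ} (hD1 : 1 ≤ D) (hℓ : 64 ≤ ell D) :
    Real.sqrt D * (⌈bigP D / bigT D ^ 2⌉₊ : ℝ) ^ 3 * ell D ^ 395 * Real.exp (-(ell D ^ 10) / 4) ≤
      Real.exp (-(1 / 8) * ell D ^ 10) := by
  have hℓ1 : (1 : ℝ) ≤ ell D := by linarith
  have hℓ0 : (0 : ℝ) < ell D := by linarith
  have hD0 : (0 : ℝ) < D := by exact_mod_cast hD1
  have hDexp : (D : ℝ) = Real.exp (ell D) := by rw [ell, Real.exp_log hD0]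
  have hT1 : 1 ≤ bigT D := Real.one_le_exp (Real.rpow_nonneg (Real.log_natCast_nonneg D) _)
  have hP0 : 0 < bigP D := Real.exp_pos _
  -- `√D ≤ D = e^{𝓛}`
  have hsqrt : Real.sqrt D ≤ Real.exp (ell D) := by
    rw [← hDexp]
    have h1 : (1 : ℝ) ≤ D := by exact_mod_cast hD1
    calc Real.sqrt D ≤ Real.sqrt D * Real.sqrt D :=
          le_mul_of_one_le_right (Real.sqrt_nonneg _) (Real.one_le_sqrt.mpr h1)
      _ = D := Real.mul_self_sqrt hD0.le
  -- `⌈P/T²⌉ ≤ P + 1 ≤ e^{𝓛⁹ + 1}`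
  have hN : (⌈bigP D / bigT D ^ 2⌉₊ : ℝ) ≤ Real.exp (ell D ^ 9 + 1) := by
    have h1 : (⌈bigP D / bigT D ^ 2⌉₊ : ℝ) < bigP D / bigT D ^ 2 + 1 := Nat.ceil_lt_add_one (by positivity)
    have h2 : bigP D / bigT D ^ 2 ≤ bigP D := div_le_self hP0.le (one_le_pow₀ hT1)
    have h3 : bigP D + 1 ≤ Real.exp (ell D ^ 9 + 1) := by
      rw [Real.exp_add, bigP]
      have := Real.add_one_le_exp (1 : ℝ)
      have h0 : 0 < Real.exp (ell D ^ 9) := Real.exp_pos _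
      nlinarith [Real.one_le_exp (show (0:ℝ) ≤ ell D ^ 9 by positivity)]
    linarith
  have hN3 : (⌈bigP D / bigT D ^ 2⌉₊ : ℝ) ^ 3 ≤ Real.exp (3 * (ell D ^ 9 + 1)) := by
    calc (⌈bigP D / bigT D ^ 2⌉₊ : ℝ) ^ 3 ≤ Real.exp (ell D ^ 9 + 1) ^ 3 :=
          pow_le_pow_left₀ (Nat.cast_nonneg _) hN 3
      _ = Real.exp (3 * (ell D ^ 9 + 1)) := by rw [← Real.exp_nat_mul]; norm_num
  -- `𝓛³⁹⁵ ≤ e^{395𝓛}`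
  have hpoly_pos : 0 < ell D ^ 395 := by positivity
  have hlog : Real.log (ell D ^ 395) ≤ 395 * ell D := by
    rw [Real.log_pow]
    have hl : Real.log (ell D) ≤ ell D := by
      have := Real.log_le_sub_one_of_pos hℓ0; linarith
    push_cast
    nlinarith
  have h10 : 64 * ell D ^ 9 ≤ ell D ^ 10 := by
    have e : ell D ^ 10 = ell D * ell D ^ 9 := by ring
    have : 0 ≤ ell D ^ 9 := by positivity
    rw [e]; nlinarith
  have h9 : 400 * ell D ≤ ell D ^ 9 := by
    have h2 : (4096 : ℝ) ≤ ell D ^ 2 := by nlinarith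
    have h2' : ell D ^ 2 ≤ ell D ^ 8 := pow_le_pow_right₀ hℓ1 (by norm_num)
    have e : ell D ^ 9 = ell D ^ 8 * ell D := by ring
    rw [e]; nlinarith
  have key : ell D + 3 * (ell D ^ 9 + 1) + Real.log (ell D ^ 395) + -(ell D ^ 10) / 4 ≤
      -(1 / 8) * ell D ^ 10 := by nlinarith
  have hE : 0 ≤ Real.exp (-(ell D ^ 10) / 4) := (Real.exp_pos _).le
  calc Real.sqrt D * (⌈bigP D / bigT D ^ 2⌉₊ : ℝ) ^ 3 * ell D ^ 395 * Real.exp (-(ell D ^ 10) / 4)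
      ≤ Real.exp (ell D) * Real.exp (3 * (ell D ^ 9 + 1)) * Real.exp (Real.log (ell D ^ 395)) *
          Real.exp (-(ell D ^ 10) / 4) := by
        rw [Real.exp_log hpoly_pos]
        gcongr
    _ = Real.exp (ell D + 3 * (ell D ^ 9 + 1) + Real.log (ell D ^ 395) + -(ell D ^ 10) / 4) := by
        rw [Real.exp_add, Real.exp_add, Real.exp_add]
    _ ≤ Real.exp (-(1 / 8) * ell D ^ 10) := Real.exp_le_exp.mpr key

/-- **u009, second half, quantitative**: for all `D ≥ ⌈e⁶⁴⌉` and every real primitive `χ (mod D)`,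
`‖τ(χ)Σ_{ψ∈Ψ} χ(p)(pt₀)^{−β₃}·(1/2πi)∫_{𝔍(−1)}KBω − τ(χ)Σ_{ψ∈Ψ} χ(p)(pt₀)^{−β₃}·(1/2π)∫_ℝ KBω(−1/2+it)dt‖
≤ C·e^{−𝓛¹⁰/8}·𝔓` with `C = 16e·S₄·C_b` (per `ψ` the bound of `segInt_sub_line_le`; `#Ψ ≤ 𝔓`
(`Ded81Edge.natCard_chr_le_frakP`), `|τ(χ)| = √D`, `|χ(p)(pt₀)^{−β₃}| ≤ 1`, and `prefactor_le`).
[cite: Zhang2022LandauSiegel, §15 p. 80, tex L4037] -/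
theorem u009_line_le (c' : ℝ) : ∃ C : ℝ, ForAllLarge fun D _ χ =>
    ‖GammaFactor.tau χ * (∑ᶠ x : Chr D,
          χ (x.p : ZMod D) * (((x.p : ℝ) * t0 D : ℝ) : ℂ) ^ (-beta3 c' D) *
            Lemma81.segInt (t0 D) (ell1 D) (-1) (fun s =>
              ktildeSeries c' x s * Bpoly χ x s * omegaW D s)) -
        GammaFactor.tau χ * ∑ᶠ x : Chr D,
          χ (x.p : ZMod D) * (((x.p : ℝ) * t0 D : ℝ) : ℂ) ^ (-beta3 c' D) *
            ((1 / (2 * π) : ℂ) * ∫ t : ℝ, ktildeSeries c' x (-1 / 2 + t * I) *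
              Bpoly χ x (-1 / 2 + t * I) * omegaW D (-1 / 2 + t * I))‖
      ≤ C * Real.exp (-(1 / 8) * ell D ^ 10) * frakP D := by
  set S₄ : ℝ := ∑' m : ℕ, MeanSquareMajorant.tau 4 m * (m : ℝ) ^ (-(3 / 2 : ℝ)) with hS₄
  set Cb : ℝ := (1 + ‖iota2‖) * (‖iota3‖ + ‖iota4‖) with hCb
  have hS₄0 : 0 ≤ S₄ := tsum_nonneg fun m => mul_nonneg (MeanSquareMajorant.tau_nonneg 4 m)
    (Real.rpow_nonneg (Nat.cast_nonneg m) _)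
  have hCb0 : 0 ≤ Cb := by positivity
  refine ⟨16 * Real.exp 1 * S₄ * Cb, ⌈Real.exp 64⌉₊, fun D _ χ hD _ hχ => ?_⟩
  beta_reduce
  classical
  haveI : Fintype (Chr D) := Fintype.ofFinite (Chr D)
  -- parameters
  have hexpD : Real.exp 64 ≤ (D : ℝ) := le_trans (Nat.le_ceil _) (by exact_mod_cast hD)
  have hDpos : (0 : ℝ) < D := lt_of_lt_of_le (Real.exp_pos _) hexpD
  have hℓ64 : 64 ≤ ell D := by rw [ell, Real.le_log_iff_exp_le hDpos]; exact hexpD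
  have hD9 : 9 ≤ D := by
    have h65 : (64 : ℝ) + 1 ≤ Real.exp 64 := Real.add_one_le_exp _
    have : ((9 : ℕ) : ℝ) ≤ (D : ℝ) := by push_cast; linarith
    exact_mod_cast this
  have hD1 : 1 ≤ D := le_trans (by norm_num) hD9
  have hℓ := Section6TailBounds.two_le_ell hD9
  have hℓ0 : 0 < ell D := by linarith
  have hℓ3 : 3 ≤ ell D := by linarith
  have hℓ₂ : 0 < ell2 D := by rw [ell2]; positivity
  have hℓ₂1 : 1 ≤ ell2 D := by rw [ell2]; exact one_le_pow₀ (by linarith)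
  have ht0 : 0 < t0 D := by rw [t0]; positivity
  -- the per-`ψ` bound
  set E : ℝ := ((D : ℝ) ^ (-(3 / 2 : ℝ)) * S₄ * (Cb * (⌈bigP D / bigT D ^ 2⌉₊ : ℝ) ^ 3) *
    (Real.sqrt π / ell2 D)) * (8 * Real.exp 1 * ell D ^ 395 * Real.exp (-(ell D ^ 10) / 4)) with hE
  have hE0 : 0 ≤ E := by
    rw [hE]
    refine mul_nonneg (mul_nonneg (mul_nonneg (mul_nonneg (Real.rpow_nonneg (Nat.cast_nonneg D) _)
      hS₄0) (by positivity)) (div_nonneg (Real.sqrt_nonneg _) hℓ₂.le)) ?_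
    exact mul_nonneg (mul_nonneg (mul_nonneg (by norm_num) (Real.exp_pos _).le)
      (pow_nonneg hℓ0.le _)) (Real.exp_pos _).le
  have hper : ∀ x : Chr D,
      ‖χ (x.p : ZMod D) * (((x.p : ℝ) * t0 D : ℝ) : ℂ) ^ (-beta3 c' D) *
            Lemma81.segInt (t0 D) (ell1 D) (-1) (fun s =>
              ktildeSeries c' x s * Bpoly χ x s * omegaW D s) -
          χ (x.p : ZMod D) * (((x.p : ℝ) * t0 D : ℝ) : ℂ) ^ (-beta3 c' D) *
            ((1 / (2 * π) : ℂ) * ∫ t : ℝ, ktildeSeries c' x (-1 / 2 + t * I) *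
              Bpoly χ x (-1 / 2 + t * I) * omegaW D (-1 / 2 + t * I))‖ ≤ E := by
    intro x
    rw [← mul_sub, norm_mul, norm_mul, norm_pt0_cpow_neg_beta3 c' x ht0, mul_one]
    calc ‖χ (x.p : ZMod D)‖ * _ ≤ 1 * E :=
          mul_le_mul (DirichletCharacter.norm_le_one _ _) (segInt_sub_line_le c' χ hD9 hℓ3 x)
            (norm_nonneg _) zero_le_one
      _ = E := one_mul _
  -- sum over `Ψ`
  rw [← mul_sub, norm_mul, norm_tau_eq_sqrt hχ, finsum_eq_sum_of_fintype, finsum_eq_sum_of_fintype,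
    ← Finset.sum_sub_distrib]
  have hcard : ((Finset.univ : Finset (Chr D)).card : ℝ) ≤ frakP D := by
    rw [Finset.card_univ, ← Nat.card_eq_fintype_card]
    exact Ded81Edge.natCard_chr_le_frakP D
  have hPf0 : 0 ≤ frakP D := le_trans (Nat.cast_nonneg _) hcard
  have hsum : ‖∑ x : Chr D,
      (χ (x.p : ZMod D) * (((x.p : ℝ) * t0 D : ℝ) : ℂ) ^ (-beta3 c' D) *
          Lemma81.segInt (t0 D) (ell1 D) (-1) (fun s =>
            ktildeSeries c' x s * Bpoly χ x s * omegaW D s) -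
        χ (x.p : ZMod D) * (((x.p : ℝ) * t0 D : ℝ) : ℂ) ^ (-beta3 c' D) *
          ((1 / (2 * π) : ℂ) * ∫ t : ℝ, ktildeSeries c' x (-1 / 2 + t * I) *
            Bpoly χ x (-1 / 2 + t * I) * omegaW D (-1 / 2 + t * I)))‖ ≤ frakP D * E := by
    refine (norm_sum_le _ _).trans ?_
    calc ∑ x : Chr D, _ ≤ ∑ _x : Chr D, E := Finset.sum_le_sum fun x _ => hper x
      _ = ((Finset.univ : Finset (Chr D)).card : ℝ) * E := by
          rw [Finset.sum_const, nsmul_eq_mul]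
      _ ≤ frakP D * E := mul_le_mul_of_nonneg_right hcard hE0
  have hpre := prefactor_le hD1 hℓ64
  -- `√π/𝓛₂ ≤ 2`, `D^{−3/2} ≤ 1`
  have hsq : Real.sqrt π / ell2 D ≤ 2 := by
    have h1 : Real.sqrt π ≤ 2 := by
      rw [Real.sqrt_le_left (by norm_num)]
      linarith [Real.pi_lt_four]
    calc Real.sqrt π / ell2 D ≤ Real.sqrt π / 1 :=
          div_le_div_of_nonneg_left (Real.sqrt_nonneg _) one_pos hℓ₂1
      _ ≤ 2 := by rw [div_one]; exact h1
  have hD32 : (D : ℝ) ^ (-(3 / 2 : ℝ)) ≤ 1 :=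
    Real.rpow_le_one_of_one_le_of_nonpos (by exact_mod_cast hD1) (by norm_num)
  have hN0 : 0 ≤ (⌈bigP D / bigT D ^ 2⌉₊ : ℝ) ^ 3 := pow_nonneg (Nat.cast_nonneg _) 3
  calc Real.sqrt D * ‖_‖ ≤ Real.sqrt D * (frakP D * E) :=
        mul_le_mul_of_nonneg_left hsum (Real.sqrt_nonneg _)
    _ = ((D : ℝ) ^ (-(3 / 2 : ℝ)) * (Real.sqrt π / ell2 D) * (8 * Real.exp 1) * S₄ * Cb) *
          (Real.sqrt D * (⌈bigP D / bigT D ^ 2⌉₊ : ℝ) ^ 3 * ell D ^ 395 *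
            Real.exp (-(ell D ^ 10) / 4)) * frakP D := by rw [hE]; ring
    _ ≤ (1 * 2 * (8 * Real.exp 1) * S₄ * Cb) * Real.exp (-(1 / 8) * ell D ^ 10) * frakP D := by
        have h8 : 0 ≤ 8 * Real.exp 1 := by positivity
        gcongr
    _ = 16 * Real.exp 1 * S₄ * Cb * Real.exp (-(1 / 8) * ell D ^ 10) * frakP D := by ring

/-- Zhang's negligible `C·e^{−𝓛¹⁰/8}` is eventually below any `η > 0`. [cite: Zhang2022LandauSiegel, §4 p. 17, tex L1062] -/
private theorem exp_neg_eventually_le (C η : ℝ) (hη : 0 < η) :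
    ∃ D₀ : ℕ, ∀ D : ℕ, D₀ ≤ D → C * Real.exp (-(1 / 8) * ell D ^ 10) ≤ η := by
  refine ⟨⌈Real.exp (max 1 (8 * (|C| + 1) / η))⌉₊, fun D hD => ?_⟩
  have hexpD : Real.exp (max 1 (8 * (|C| + 1) / η)) ≤ (D : ℝ) := le_trans (Nat.le_ceil _) (by exact_mod_cast hD)
  have hDpos : (0 : ℝ) < D := lt_of_lt_of_le (Real.exp_pos _) hexpD
  have hℓ : max 1 (8 * (|C| + 1) / η) ≤ ell D := by rw [ell, Real.le_log_iff_exp_le hDpos]; exact hexpD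
  have hℓ1 : 1 ≤ ell D := le_trans (le_max_left _ _) hℓ
  have hℓ2 : 8 * (|C| + 1) / η ≤ ell D := le_trans (le_max_right _ _) hℓ
  have hℓ10 : ell D ≤ ell D ^ 10 := by
    calc ell D = ell D ^ 1 := (pow_one _).symm
      _ ≤ ell D ^ 10 := pow_le_pow_right₀ hℓ1 (by norm_num)
  have hE := Real.add_one_le_exp ((1 / 8) * ell D ^ 10)
  have hCle : 8 * (|C| + 1) ≤ ell D * η := (div_le_iff₀ hη).mp hℓ2
  have hEpos : 0 < Real.exp ((1 / 8) * ell D ^ 10) := Real.exp_pos _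
  rw [neg_mul, Real.exp_neg, ← div_eq_mul_inv, div_le_iff₀ hEpos]
  calc C ≤ |C| := le_abs_self C
    _ ≤ η * ((1 / 8) * ell D) := by nlinarith
    _ ≤ η * ((1 / 8) * ell D ^ 10) := by nlinarith
    _ ≤ η * Real.exp ((1 / 8) * ell D ^ 10) := mul_le_mul_of_nonneg_left (by linarith) hη.le

/-- **`Z22:§15.u009`, second half, HOLDS** (§15 p. 80, tex L4037: "… the segment `𝔍(−1)` can be
replaced by the line `σ = −1/2`, with acceptable errors"): for every `ε > 0`, all large `D`, all real
primitive `χ (mod D)` (Assumption (A) is not used),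
`‖τ(χ)Σ_{ψ∈Ψ}χ(p)(pt₀)^{−β₃}(1/2πi)∫_{𝔍(−1)}KBω − τ(χ)Σ_{ψ∈Ψ}χ(p)(pt₀)^{−β₃}(1/2π)∫_ℝ KBω(−1/2+it)dt‖ ≤ ε𝔓`
— the statement `Typed.Section15A.Step15_u009b c′` of the typer's sub-step file with its abbreviations
`termSegU009`/`termLineU009` unfolded. [cite: Zhang2022LandauSiegel, §15 p. 80, tex L4037] -/
theorem u009_line_eventually (c' : ℝ) : ∀ ε : ℝ, 0 < ε → ForAllLarge fun D _ χ => AssumptionA D χ →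
    ‖GammaFactor.tau χ * (∑ᶠ x : Chr D,
          χ (x.p : ZMod D) * (((x.p : ℝ) * t0 D : ℝ) : ℂ) ^ (-beta3 c' D) *
            Lemma81.segInt (t0 D) (ell1 D) (-1) (fun s =>
              ktildeSeries c' x s * Bpoly χ x s * omegaW D s)) -
        GammaFactor.tau χ * ∑ᶠ x : Chr D,
          χ (x.p : ZMod D) * (((x.p : ℝ) * t0 D : ℝ) : ℂ) ^ (-beta3 c' D) *
            ((1 / (2 * π) : ℂ) * ∫ t : ℝ, ktildeSeries c' x (-1 / 2 + t * I) *
              Bpoly χ x (-1 / 2 + t * I) * omegaW D (-1 / 2 + t * I))‖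
      ≤ ε * frakP D := by
  intro ε hε
  obtain ⟨C, D₀, hD₀⟩ := u009_line_le c'
  obtain ⟨D₁, hD₁⟩ := exp_neg_eventually_le C ε hε
  refine ⟨max D₀ D₁, fun D _ χ hD hq hp _ => ?_⟩
  have h1 := hD₀ D χ (le_trans (le_max_left _ _) hD) hq hp
  have h2 := hD₁ D (le_trans (le_max_right _ _) hD)
  have hPf0 : 0 ≤ frakP D := by
    rw [frakP_eq_sum_primeWindow]; exact Finset.sum_nonneg fun p _ => Nat.cast_nonneg p
  exact h1.trans (mul_le_mul_of_nonneg_right h2 hPf0)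

end Literature.NumberTheory.LFunctions.Zhang2022.Typed.Section15A.U009
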